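import Summits.QuantumFields.QCD.Theses.EulerDescent
import Literature.MathematicalPhysics.QuantumFieldTheory.QCDCurrentSector
import Summits.QuantumFields.QCD.Theorems.EulerDescentChiralCornerSoftnessStubSlabFluxBound
import Summits.QuantumFields.QCD.Theorems.EulerDescentChiralCornerSoftnessStubTwistStabilityZeroTwist
import Summits.QuantumFields.QCD.Theorems.EulerDescentChiralCornerSoftnessStubCondensateFluxFloorDenominatorReal
import Summits.QuantumFields.QCD.Theorems.EulerDescentChiralCornerSoftnessStubCondensateFluxFloorRayZerosFinite

/-!
# Line `Sketch` (twisted-ray Goldstone bound) for crux `ChiralCornerSoftness` (item stmt-QuantumFields-16902) —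
# `Lines/Sketch.lean`, the lead's skeleton

Route `route-QuantumFields-EulerDescent` (sub-problem QCD), crux decl
`Summit.QuantumFields.QCD.Theses.EulerDescent.ChiralCornerSoftness` (rank 4): for `N_f ∈ {2,3}`, every regularisation
PINNED AT THE INTRINSIC WILSON CORNER (corner `IsLUB` eventually, pin `(m_crit − mc)·Z_m/a → 0`, `HasMassScaling`,
two-loop `HasAsymptoticScaling`, `m_crit > −1` eventually) is chiral at zero (`reg.IsChiralAtZero`).

Authored by the line lead `prover-line-stmt-QuantumFields-16902-0` (2026-08-17), continued by `…-c1-0`, from idea card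
`Ideas/twisted-ray-goldstone.md` (ideator 2, whose first lemmas — all proved — are the payload line file
`SketchIdeator2.lean`; that file has no `ChiralCornerSoftness_of`, so the skeleton is written here).

## The line (a REDUCTIO at positive masses and positive twist; no `m = 0` theory, no continuum object)

Add to the crux's untwisted Wilson action a TWISTED MASS `i μ_lat ψ̄ γ₅ τ³ ψ` on the flavour doublet `(f, g)`
(`τ³ = E_ff − E_gg`), at the pinned bare mass `m_crit(k) + a_k t / Z_m(k)` (all flavours) and `μ_lat = a_k μ / Z_m(k)`:
the ray of angle `atan(μ/t)` from the PIN.  The flavour rotation generated by `τ²` is an EXACT symmetry of the Wilson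
term, broken only (and explicitly) by the twisted mass, so its Ward identity is exact lattice algebra: the backward
divergence of the conserved point-split current `Ṽ²_ν` (`conservedVectorCurrent Nf τ²`) equals `2 μ_lat` times the
density `P¹ = ψ̄ γ₅ τ¹ ψ` (`pseudoscalarDensityObs Nf τ¹`), up to a sign.  Summed over the complement of the time slab
`|y₀| < s₀` on the torus of side `N = 2S+1` (Gauss), it bounds the FLUX `Φ(s₀)` of `Ṽ²₀` through the two slices
`s₀ − 1`, `N − s₀` against the charged density at the origin by `2 μ_lat Σ_{s = s₀}^{N − s₀} ‖C(s)‖`, `C(s)` the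
zero-momentum `P¹P¹` correlator at time `s` — stub `stub_slabFluxBound` (E1, PROVABLE NOW: Berezin change of
variables; registered in the sign-free inequality form the composition consumes).  Then:

  ¬`IsChiralAtZero` ⇒ ONE rate `ε` at ALL positive tuples (`uniformGap_of_not_isChiralAtZero`)
  ⇒ [`stub_twistStability`, E5] the twisted theory on the 45° ray `(t, t)`, `t ∈ (0,1]`, has the uniform twisted gap
    `ε/2` (continuum-equivalent to the untwisted theory at the rotated tuple `(√2 t, √2 t, t, …)`, which is a positive
    tuple and therefore gapped at `ε` by the reductio hypothesis; lattice artefacts `O(a²)` vanish eventually in `k`)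
  ⇒ [`stub_twistedPPCeiling`, E2+E4 merged] a CEILING WITH DECAY for the zero-momentum charged correlator from physical
    time `τ` on: `‖C_k,S(s)‖ ≤ c̄ a_k³ Z_m(k)² (e^{−(ε/2)(a_k s − τ)} + e^{−(ε/2)(a_k(N − s) − τ)})`, `c̄ = c̄(ε, τ)`
    UNIFORM on the small rays (reflection positivity / transfer-matrix regularity under the gap; `m_crit > −1` is the
    positivity range of the twisted transfer matrix, Frezzotti–Sint–Weisz)
  ⇒ [E1 + two geometric sums, PROVED below] `(a_k³ Z_m(k))⁻¹ ‖Φ_k,S(⌈τ/a_k⌉)‖ ≤ 8 K c̄ t / ε` eventually in `k`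
  ⇒ contradiction, for `t < ε φ₀ /(8 K c̄)`, with [`stub_condensateFluxFloor`, E3, THE OPEN χSB INPUT, hardest] the
    renormalised flux floor `φ₀ ≤ (a_k³ Z_m(k))⁻¹ ‖Φ_k,S(⌈τ/a_k⌉)‖` on the 45° ray for all small `t`, eventually in `k`,
    on the clause's tori `S ≥ L_k` — the condensate rotated into the subtraction-free `P³` direction, read as a
    conserved-current flux at physical distance `τ` (GMOR: `≈ Σ sin ω e^{−M_π τ}`); corner + pin are consumed HERE
    (a mis-pinned origin tilts the true ray angle to `0` and the floor fails, as it must by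
    `RobustYangMillsHandover.Negative.not_isChiralAtZero_mcrit_shift_of_uniformGapAbove`).

STATUS (lead -0, cycle 1, 2026-08-17): E1 `stub_slabFluxBound` LANDED (p169063 + helpers p168585/p168696/p168804, exact identity
`Φ(s₀) = −2μ_lat Σ C(s)`, `K = 2`) and is now IMPORTED; three stubs remain (E5, E2+E4, E3).  Periphery landed by lead -0:
centring `⟨P¹⟩_tw = ⟨Ṽ²₀⟩_tw = 0` (p169560) and `N_f = 2` non-degeneracy `Z_tw > 0` (p169610).
STATUS (lead -c1, cycle 1, 2026-08-17T19Z): wave of three registered periphery stubs LANDED and imported (§3b): the zero-twist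
slice `TwGap t 0 Δ ↔ HasLatticeMassGap Δ` of the untwisted degenerate scheme (p172396: E5's interface is the crux's own clause
on the untwisted axis), realness of the twisted denominator for every `N_f`, `f ≠ g` (p172463) and finiteness of its junk zeros
in `t` on every ray `(m_c + ct, ct)`, `c ≠ 0`, at fixed `(β, S)` (p172610: E3's `∃ t ≤ t₁` dodge costs a countable set of `t`).
The three physics stubs are unchanged and OPEN: E5 (twisted/untwisted rate transfer at equal `(β_k, a_k)` — Symanzik-grade
universality, no published theorem), E2+E4 (UV finiteness of the renormalised zero-momentum `P¹P¹` correlator at physical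
time `τ`, uniform in `t`, plus the transfer-matrix reading of the graded torus functional; the abstract decay upgrade is the
tree's `TransferData.re_inner_pow_le_mul_pow_of_eventually`), E3 (χSB in order-parameter/flux form = the INPUT of this
Goldstone-type argument; nearest prior art Landau–Perez–Wreszinski 1981, Salmhofer–Seiler 1991 (staggered, β = 0),
Goto–Koma 2022/24 (lattice NJL): none covers Wilson quarks at any coupling).  Reshape v2 (after wave 1):
E2+E4's conclusion has rate slack `ε/4` (finite-torus spectral leakage) and its own volume threshold `∃ L'`; E3's floor its
own threshold `∃ L'` and the `∀ t₁ > 0, ∃ t ≤ t₁` form (SOME arbitrarily small ray parameter, dodging junk-zero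
denominators of the `N_f = 3` signed third determinant at isolated `t`); the composition meets them on `S = max(L_k, L'_k, L''_k)`.

All four stubs are load-bearing (E1/E24 bound the flux from above only under the twisted gap, which only E5 supplies
from the reductio hypothesis; E3 alone bounds it from below).  Reshape at adoption (lead, recorded in PICKED.md): the
card's E2 "`C_PP` completely monotone ⇒ one-step drop" is not provable for the tree's `(−1)^F`-graded finite-torus
functional and for zero-momentum sums (the gap clause controls each pair with its own constant), so it is merged with E4
into `stub_twistedPPCeiling`; the proved sequence lemmas `ratio_le_of_logConvex_of_decay` / `flux_rate_bound` of
`SketchIdeator2.lean` are kept as landed helpers for the day E24 is split back.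

## Layout

§0 file-local named definitions of the twisted objects (documentation + the composition's vocabulary); §1 the four stub
STATEMENTS `Stmt.stub_*` (raw, self-contained over tree vocabulary: the objects are restated INLINE with `let`, so that a
worker's Theorems file can state the identical signature importing only `QCDCurrentSector` + the route file); §2 the
registered `theorem stub_*` (the ONLY `sorry`s); §3 `Iff.rfl` bridges raw ↔ named; §3b landed certificates (zero-twist slice,
realness and finiteness of junk zeros of the twisted denominator); §4 real-analysis helpers (proved);
§5 `ChiralCornerSoftness_of` (kernel-checked) and `chiralCornerSoftness_of_stubs`.
-/

noncomputable section

namespace Summit.QuantumFields.QCD.Cruxes.ChiralCornerSoftness.TwistedRay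

open Filter Topology MeasureTheory
open Literature.MathematicalPhysics.QuantumFieldTheory Literature.MathematicalPhysics.QuantumLattice
  Literature.Probability.LatticeModels
open Summit.QuantumFields.QCD.Theses.EulerDescent (ChiralCornerSoftness)

/-! ## §0 The twisted objects (file-local names) -/

section Defs

variable {Nf : ℕ}

/-- `τ¹` on the doublet `(f,g)`: `E_fg + E_gf`. [folklore] -/
def tau1 (f g : Fin Nf) : Matrix (Fin Nf) (Fin Nf) ℂ := Matrix.single f g 1 + Matrix.single g f 1

/-- `τ²` on the doublet `(f,g)`: `−i E_fg + i E_gf`. [folklore] -/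
def tau2 (f g : Fin Nf) : Matrix (Fin Nf) (Fin Nf) ℂ :=
  (-Complex.I) • Matrix.single f g 1 + Complex.I • Matrix.single g f 1

/-- The charged pseudoscalar density `P¹ = ψ̄ γ₅ τ¹ ψ` at the origin (quark box 1). [folklore] -/
def chargedP (f g : Fin Nf) : QCDLatticeObservable Nf 1 := pseudoscalarDensityObs Nf (tau1 f g)

/-- The time component of the conserved point-split flavour current `Ṽ²₀` at the origin. [folklore] -/
def flavourV0 (f g : Fin Nf) : QCDLatticeObservable Nf 1 := conservedVectorCurrent Nf (tau2 f g) 0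

/-- The twisted-mass matrix `i μ_lat γ₅ τ³` (flavour `f`: `+`, flavour `g`: `−`, others `0`; site- and colour-diagonal)
on the quark variables of the torus of side `2S+1`. [cite: FrezzottiGrassiSintWeisz2001, §2.1] -/
def twistMatrix (f g : Fin Nf) (S : ℕ) (μl : ℝ) :
    Matrix (FermiIdx Nf (2 * S + 1)) (FermiIdx Nf (2 * S + 1)) ℂ :=
  Matrix.reindex (quarkEquiv (Nf := Nf) (L := 2 * S + 1)) quarkEquiv (Matrix.of fun v w : QuarkVar Nf (2 * S + 1) =>
    if v.1 = w.1 ∧ v.2.1 = w.2.1 ∧ v.2.2.1 = w.2.2.1 then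
      (if v.1 = f then (1 : ℂ) else if v.1 = g then -1 else 0) * ((μl : ℂ) * Complex.I) * gammaFive v.2.2.2 w.2.2.2
    else 0)

/-- **Twisted torus expectation** at inverse coupling `β`, degenerate bare Wilson mass `m₀` and twisted mass `μl` on
`(f,g)`: `⟨X⟩ = ∫dμ_W ∫dψ̄dψ X e^{−ψ̄(D(U,m₀) + iμlγ₅τ³)ψ} / ∫dμ_W ∫dψ̄dψ e^{−ψ̄(D + iμlγ₅τ³)ψ}` (junk `0` if the
denominator vanishes; at `μl = 0` it is `qcdTorusExpect β (2S+1) (fun _ => m₀) X`). [cite: FrezzottiGrassiSintWeisz2001, §2.1] -/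
def twExpect (f g : Fin Nf) (β m₀ μl : ℝ) (S : ℕ)
    (X : GaugeConfig 4 (2 * S + 1) (Matrix.specialUnitaryGroup (Fin 3) ℂ) → FermiAlg Nf (2 * S + 1)) : ℂ :=
  (∫ U, fermiIntegral (X U * grassmannExp (quadratic ℂ (-(diracMatrix U (fun _ : Fin Nf => m₀) +
      twistMatrix f g S μl)))) ∂(wilsonMeasure (d := 4) (L := 2 * S + 1) (fundamentalRep (Fin 3)) β)) /
    (∫ U, fermiIntegral (grassmannExp (quadratic ℂ (-(diracMatrix U (fun _ : Fin Nf => m₀) +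
      twistMatrix f g S μl)))) ∂(wilsonMeasure (d := 4) (L := 2 * S + 1) (fundamentalRep (Fin 3)) β))

/-- The zero-momentum charged correlator `C(s) = Σ_{y⃗} ⟨P¹(0) P¹(s, y⃗)⟩_tw` at Euclidean time `s`. [folklore] -/
def zeroMomPP (f g : Fin Nf) (β m₀ μl : ℝ) (S : ℕ) (s : ℤ) : ℂ :=
  ∑ y ∈ box 3 S, twExpect f g β m₀ μl S (fun U => (chargedP f g).onTorus (2 * S + 1) 0 U *
    (chargedP f g).onTorus (2 * S + 1) (Matrix.vecCons s y) U)

/-- The slab flux `Φ(s₀) = Σ_{y⃗} ⟨(Ṽ²₀(s₀ − 1, y⃗) − Ṽ²₀(−s₀, y⃗)) P¹(0)⟩_tw` of the flavour current through the two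
time slices bounding the complement of the slab `|y₀| < s₀` on the torus of side `2S+1`. [folklore] -/
def slabFlux (f g : Fin Nf) (β m₀ μl : ℝ) (S : ℕ) (s₀ : ℕ) : ℂ :=
  ∑ y ∈ box 3 S, twExpect f g β m₀ μl S (fun U =>
    ((flavourV0 f g).onTorus (2 * S + 1) (Matrix.vecCons ((s₀ : ℤ) - 1) y) U -
      (flavourV0 f g).onTorus (2 * S + 1) (Matrix.vecCons (-(s₀ : ℤ)) y) U) * (chargedP f g).onTorus (2 * S + 1) 0 U)

/-- The time slab `s₀ ≤ s ≤ 2S+1−s₀` as a finite set of natural times (no ℕ-subtraction). [folklore] -/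
def slab (S s₀ : ℕ) : Finset ℕ := (Finset.range (2 * S + 2)).filter (fun s => s₀ ≤ s ∧ s + s₀ ≤ 2 * S + 1)

/-- **Uniform twisted lattice gap `Δ` on the ray point `(t, μ)` from the pin** of the regularisation `reg` (the twin of
`QCDScheme.HasLatticeMassGap` for the twisted doublet `(f,g)`: every pair of gauge-invariant local observables clusters in
Euclidean time at physical rate `Δ` on all tori `S ≥ L_k`, eventually in `k`). [folklore] -/
def TwistedGap (reg : QCDRegularisation Nf) (f g : Fin Nf) (t μ Δ : ℝ) : Prop :=
  ∀ (R R' : ℕ) (A : QCDLatticeObservable Nf R) (B : QCDLatticeObservable Nf R'), ∃ Cc : ℝ, ∀ᶠ k in atTop,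
    ∀ S : ℕ, reg.L k ≤ S → ∀ n : ℕ, n ≤ S →
      ‖twExpect f g (reg.β k) (reg.mcrit k + reg.a k * t / reg.Zm k) (reg.a k * μ / reg.Zm k) S
            (fun U => A.onTorus (2 * S + 1) 0 U * B.onTorus (2 * S + 1) (Pi.single 0 (n : ℤ)) U) -
          twExpect f g (reg.β k) (reg.mcrit k + reg.a k * t / reg.Zm k) (reg.a k * μ / reg.Zm k) S
              (A.onTorus (2 * S + 1) 0) *
            twExpect f g (reg.β k) (reg.mcrit k + reg.a k * t / reg.Zm k) (reg.a k * μ / reg.Zm k) S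
              (B.onTorus (2 * S + 1) (Pi.single 0 (n : ℤ)))‖ ≤
        Cc * Real.exp (-(Δ * (reg.a k * n)))

end Defs

/-! ## §1 The four stub STATEMENTS as named propositions (raw, self-contained; hypotheses of `ChiralCornerSoftness_of`) -/

namespace Stmt

/-- **Statement of stub E1 — the slab flux bound (exact twisted Ward identity, inequality form).** There is a universal
`K ≥ 0` (the identity gives `K = 2`) such that for every `N_f`, doublet `f ≠ g`, coupling `β`, degenerate bare mass `m₀`,
twisted mass `μl ≥ 0`, torus `2S+1` and slab `1 ≤ s₀ ≤ S`:
`‖Φ(s₀)‖ ≤ K μl Σ_{s₀ ≤ s ≤ 2S+1−s₀} ‖C(s)‖`. [folklore] -/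
def stub_slabFluxBound : Prop :=
  ∃ K : ℝ, 0 ≤ K ∧ ∀ (Nf : ℕ) (f g : Fin Nf), f ≠ g → let τ1 : Matrix (Fin Nf) (Fin Nf) ℂ := Matrix.single f g 1 + Matrix.single g f 1; let τ2 : Matrix (Fin Nf) (Fin Nf) ℂ := (-Complex.I) • Matrix.single f g 1 + Complex.I • Matrix.single g f 1; let P1 : QCDLatticeObservable Nf 1 := pseudoscalarDensityObs Nf τ1; let V2 : QCDLatticeObservable Nf 1 := conservedVectorCurrent Nf τ2 0; let Tw := fun (S : ℕ) (μl : ℝ) => Matrix.reindex (quarkEquiv (Nf := Nf) (L := 2 * S + 1)) quarkEquiv (Matrix.of fun v w : QuarkVar Nf (2 * S + 1) => if v.1 = w.1 ∧ v.2.1 = w.2.1 ∧ v.2.2.1 = w.2.2.1 then (if v.1 = f then (1 : ℂ) else if v.1 = g then -1 else 0) * ((μl : ℂ) * Complex.I) * gammaFive v.2.2.2 w.2.2.2 else 0); let E := fun (β m₀ μl : ℝ) (S : ℕ) (X : GaugeConfig 4 (2 * S + 1) (Matrix.specialUnitaryGroup (Fin 3) ℂ) → FermiAlg Nf (2 * S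 + 1)) => (∫ U, fermiIntegral (X U * grassmannExp (quadratic ℂ (-(diracMatrix U (fun _ : Fin Nf => m₀) + Tw S μl)))) ∂(wilsonMeasure (d := 4) (L := 2 * S + 1) (fundamentalRep (Fin 3)) β)) / (∫ U, fermiIntegral (grassmannExp (quadratic ℂ (-(diracMatrix U (fun _ : Fin Nf => m₀) + Tw S μl)))) ∂(wilsonMeasure (d := 4) (L := 2 * S + 1) (fundamentalRep (Fin 3)) β)); let C := fun (β m₀ μl : ℝ) (S : ℕ) (s : ℤ) => ∑ y ∈ box 3 S, E β m₀ μl S (fun U => P1.onTorus (2 * S + 1) 0 U * P1.onTorus (2 * S + 1) (Matrix.vecCons s y) U); let Φ := fun (β m₀ μl : ℝ) (S : ℕ) (s₀ : ℕ) => ∑ y ∈ box 3 S, E β m₀ μl S (fun U => (V2.onTorus (2 * S + 1) (Matrix.vecCons ((s₀ : ℤ) - 1) y) U - V2.onTorus (2 * S + 1) (Matrix.vecCons (-(s₀ : ℤ)) y) U) * P1.onTorus (2 * S + 1) 0 U); ∀ (β m₀ μl : ℝ) (S s₀ : ℕ), 0 ≤ μl → 1 ≤ s₀ → s₀ ≤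 S → ‖Φ β m₀ μl S s₀‖ ≤ K * μl * ∑ s ∈ (Finset.range (2 * S + 2)).filter (fun s => s₀ ≤ s ∧ s + s₀ ≤ 2 * S + 1), ‖C β m₀ μl S s‖

/-- **Statement of stub E5 — twist stability (inside the reductio).** For a corner-pinned regularisation, one uniform
lattice rate `ε` at ALL positive tuples forces the uniform twisted gap `ε/2` on the 45° ray `(t,t)`, `t ∈ (0,1]`, from
the pin. [folklore] -/
def stub_twistStability : Prop :=
  ∀ Nf : ℕ, Nf = 2 ∨ Nf = 3 → ∀ (reg : QCDRegularisation Nf) (mc : ℕ → ℝ),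
    (∀ᶠ k in atTop, IsLUB {μ : ℝ | ¬ (∀ (R R' : ℕ) (A : QCDLatticeObservable Nf R)
        (B : QCDLatticeObservable Nf R'), ∃ (C δ : ℝ) (S₀ : ℕ), 0 < δ ∧ ∀ S : ℕ, S₀ ≤ S → ∀ n : ℕ, n ≤ S →
          ‖qcdLatticeConnectedCorr (reg.β k) (2 * S + 1) (fun _ : Fin Nf => μ) A B n‖ ≤
            C * Real.exp (-(δ * n)))} (mc k)) →
    Tendsto (fun k => (reg.mcrit k - mc k) * reg.Zm k / reg.a k) atTop (nhds 0) →
    reg.HasMassScaling → (reg.scheme 0 0 0).HasAsymptoticScaling →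
    (∀ᶠ k in atTop, (-1 : ℝ) < reg.mcrit k) →
    ∀ (f g : Fin Nf), f ≠ g → let Tw := fun (S : ℕ) (μl : ℝ) => Matrix.reindex (quarkEquiv (Nf := Nf) (L := 2 * S + 1)) quarkEquiv (Matrix.of fun v w : QuarkVar Nf (2 * S + 1) => if v.1 = w.1 ∧ v.2.1 = w.2.1 ∧ v.2.2.1 = w.2.2.1 then (if v.1 = f then (1 : ℂ) else if v.1 = g then -1 else 0) * ((μl : ℂ) * Complex.I) * gammaFive v.2.2.2 w.2.2.2 else 0); let E := fun (β m₀ μl : ℝ) (S : ℕ) (X : GaugeConfig 4 (2 * S + 1) (Matrix.specialUnitaryGroup (Fin 3) ℂ) → FermiAlg Nf (2 * S + 1)) => (∫ U, fermiIntegral (X U * grassmannExp (quadratic ℂ (-(diracMatrix U (fun _ : Fin Nf => m₀) + Tw S μl)))) ∂(wilsonMeasure (d := 4) (L := 2 * S + 1) (fundamentalRep (Fin 3)) β)) / (∫ U, fermiIntegral (grassmannExp (quadratic ℂ (-(diracMatrix U (fun _ : Fin Nf => m₀) + Tw S μl)))) ∂(wilsonMeasure (d := 4) (L := 2 * S + 1)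 (fundamentalRep (Fin 3)) β)); let TwGap := fun (t μ Δ : ℝ) => ∀ (R R' : ℕ) (A : QCDLatticeObservable Nf R) (B : QCDLatticeObservable Nf R'), ∃ Cc : ℝ, ∀ᶠ k in atTop, ∀ S : ℕ, reg.L k ≤ S → ∀ n : ℕ, n ≤ S → ‖E (reg.β k) (reg.mcrit k + reg.a k * t / reg.Zm k) (reg.a k * μ / reg.Zm k) S (fun U => A.onTorus (2 * S + 1) 0 U * B.onTorus (2 * S + 1) (Pi.single 0 (n : ℤ)) U) - E (reg.β k) (reg.mcrit k + reg.a k * t / reg.Zm k) (reg.a k * μ / reg.Zm k) S (A.onTorus (2 * S + 1) 0) * E (reg.β k) (reg.mcrit k + reg.a k * t / reg.Zm k) (reg.a k * μ / reg.Zm k) S (B.onTorus (2 * S + 1) (Pi.single 0 (n : ℤ)))‖ ≤ Cc * Real.exp (-(Δ * (reg.a k * n))); ∀ ε : ℝ, 0 < ε → (∀ m : Fin Nf → ℝ, (∀ i, 0 < m i) → (reg.scheme m 0 0).HasLatticeMassGap ε) → ∀ t : ℝ, 0 < t → t ≤ 1 → TwGap t t (ε / 2)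

/-- **Statement of stub E2+E4 — the twisted `P¹P¹` ceiling with decay under the twisted gap.** For a corner-pinned
regularisation, `ε > 0` and a physical time `τ > 0` there is `c̄ ≥ 0` such that on every 45° ray point `(t,t)`,
`t ∈ (0,1]`, carrying the uniform twisted gap `ε/2`, eventually in `k`, on all tori `S ≥ L_k`, for all times `s` with
`τ ≤ a_k s` and `τ ≤ a_k (2S+1−s)`:
`‖C_k,S(s)‖ ≤ c̄ a_k³ Z_m(k)² (e^{−(ε/2)(a_k s − τ)} + e^{−(ε/2)(a_k(2S+1−s) − τ)})`. [folklore] -/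
def stub_twistedPPCeiling : Prop :=
  ∀ Nf : ℕ, Nf = 2 ∨ Nf = 3 → ∀ (reg : QCDRegularisation Nf) (mc : ℕ → ℝ),
    (∀ᶠ k in atTop, IsLUB {μ : ℝ | ¬ (∀ (R R' : ℕ) (A : QCDLatticeObservable Nf R)
        (B : QCDLatticeObservable Nf R'), ∃ (C δ : ℝ) (S₀ : ℕ), 0 < δ ∧ ∀ S : ℕ, S₀ ≤ S → ∀ n : ℕ, n ≤ S →
          ‖qcdLatticeConnectedCorr (reg.β k) (2 * S + 1) (fun _ : Fin Nf => μ) A B n‖ ≤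
            C * Real.exp (-(δ * n)))} (mc k)) →
    Tendsto (fun k => (reg.mcrit k - mc k) * reg.Zm k / reg.a k) atTop (nhds 0) →
    reg.HasMassScaling → (reg.scheme 0 0 0).HasAsymptoticScaling →
    (∀ᶠ k in atTop, (-1 : ℝ) < reg.mcrit k) →
    ∀ (f g : Fin Nf), f ≠ g → let τ1 : Matrix (Fin Nf) (Fin Nf) ℂ := Matrix.single f g 1 + Matrix.single g f 1; let P1 : QCDLatticeObservable Nf 1 := pseudoscalarDensityObs Nf τ1; let Tw := fun (S : ℕ) (μl : ℝ) => Matrix.reindex (quarkEquiv (Nf := Nf) (L := 2 * S + 1)) quarkEquiv (Matrix.of fun v w : QuarkVar Nf (2 * S + 1) => if v.1 = w.1 ∧ v.2.1 = w.2.1 ∧ v.2.2.1 = w.2.2.1 then (if v.1 = f then (1 : ℂ) else if v.1 = g then -1 else 0) * ((μl : ℂ) * Complex.I) * gammaFive v.2.2.2 w.2.2.2 else 0); let E := fun (β m₀ μl : ℝ) (S : ℕ) (X : GaugeConfig 4 (2 * S + 1) (Matrix.specialUnitaryGroup (Fin 3) ℂ) → FermiAlg Nf (2 * S + 1)) =>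 (∫ U, fermiIntegral (X U * grassmannExp (quadratic ℂ (-(diracMatrix U (fun _ : Fin Nf => m₀) + Tw S μl)))) ∂(wilsonMeasure (d := 4) (L := 2 * S + 1) (fundamentalRep (Fin 3)) β)) / (∫ U, fermiIntegral (grassmannExp (quadratic ℂ (-(diracMatrix U (fun _ : Fin Nf => m₀) + Tw S μl)))) ∂(wilsonMeasure (d := 4) (L := 2 * S + 1) (fundamentalRep (Fin 3)) β)); let C := fun (β m₀ μl : ℝ) (S : ℕ) (s : ℤ) => ∑ y ∈ box 3 S, E β m₀ μl S (fun U => P1.onTorus (2 * S + 1) 0 U * P1.onTorus (2 * S + 1) (Matrix.vecCons s y) U); let TwGap := fun (t μ Δ : ℝ) => ∀ (R R' : ℕ) (A : QCDLatticeObservable Nf R) (B : QCDLatticeObservable Nf R'), ∃ Cc : ℝ, ∀ᶠ k in atTop, ∀ S : ℕ, reg.L k ≤ S → ∀ n : ℕ, n ≤ S → ‖E (reg.β k) (reg.mcrit k + reg.a k * t / reg.Zm k) (reg.a k * μ / reg.Zm k) S (fun U => A.onTorus (2 * S + 1) 0 U * B.onTorus (2 * S + 1) (Pi.single 0 (n :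 ℤ)) U) - E (reg.β k) (reg.mcrit k + reg.a k * t / reg.Zm k) (reg.a k * μ / reg.Zm k) S (A.onTorus (2 * S + 1) 0) * E (reg.β k) (reg.mcrit k + reg.a k * t / reg.Zm k) (reg.a k * μ / reg.Zm k) S (B.onTorus (2 * S + 1) (Pi.single 0 (n : ℤ)))‖ ≤ Cc * Real.exp (-(Δ * (reg.a k * n))); ∀ ε : ℝ, 0 < ε → ∀ τ : ℝ, 0 < τ → ∃ cbar : ℝ, 0 ≤ cbar ∧ ∀ t : ℝ, 0 < t → t ≤ 1 → TwGap t t (ε / 2) → ∃ L' : ℕ → ℕ, ∀ᶠ k in atTop, ∀ S : ℕ, L' k ≤ S → ∀ s : ℕ, τ ≤ reg.a k * s → τ ≤ reg.a k * ((2 * S + 1 : ℝ) - s) → ‖C (reg.β k) (reg.mcrit k + reg.a k * t / reg.Zm k) (reg.a k * t / reg.Zm k) S s‖ ≤ cbar * reg.a k ^ 3 * reg.Zm k ^ 2 * (Real.exp (-(ε / 4 * (reg.a k * s - τ))) + Real.exp (-(ε / 4 * (reg.a k * ((2 * S + 1 : ℝ) - s) - τ))))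

/-- **Statement of stub E3 — the condensate flux floor on the 45° ray from the pin (χSB in exact-symmetry flux form;
OPEN, hardest).** For a corner-pinned regularisation and a doublet `f ≠ g` there are `φ₀ > 0` and a physical time `τ > 0`
such that below every `t₁ > 0` some ray parameter `t ∈ (0, t₁]` has, on tori above its own threshold `S ≥ L'_k`
(with `⌈τ/a_k⌉ ≤ S`), eventually in `k`:
`φ₀ ≤ (a_k³ Z_m(k))⁻¹ ‖Φ_k,S(⌈τ/a_k⌉)‖` at the ray point `(t, t)`. [folklore] -/
def stub_condensateFluxFloor : Prop :=
  ∀ Nf : ℕ, Nf = 2 ∨ Nf = 3 → ∀ (reg : QCDRegularisation Nf) (mc : ℕ → ℝ),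
    (∀ᶠ k in atTop, IsLUB {μ : ℝ | ¬ (∀ (R R' : ℕ) (A : QCDLatticeObservable Nf R)
        (B : QCDLatticeObservable Nf R'), ∃ (C δ : ℝ) (S₀ : ℕ), 0 < δ ∧ ∀ S : ℕ, S₀ ≤ S → ∀ n : ℕ, n ≤ S →
          ‖qcdLatticeConnectedCorr (reg.β k) (2 * S + 1) (fun _ : Fin Nf => μ) A B n‖ ≤
            C * Real.exp (-(δ * n)))} (mc k)) →
    Tendsto (fun k => (reg.mcrit k - mc k) * reg.Zm k / reg.a k) atTop (nhds 0) →
    reg.HasMassScaling → (reg.scheme 0 0 0).HasAsymptoticScaling →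
    (∀ᶠ k in atTop, (-1 : ℝ) < reg.mcrit k) →
    ∀ (f g : Fin Nf), f ≠ g → let τ1 : Matrix (Fin Nf) (Fin Nf) ℂ := Matrix.single f g 1 + Matrix.single g f 1; let τ2 : Matrix (Fin Nf) (Fin Nf) ℂ := (-Complex.I) • Matrix.single f g 1 + Complex.I • Matrix.single g f 1; let P1 : QCDLatticeObservable Nf 1 := pseudoscalarDensityObs Nf τ1; let V2 : QCDLatticeObservable Nf 1 := conservedVectorCurrent Nf τ2 0; let Tw := fun (S : ℕ) (μl : ℝ) => Matrix.reindex (quarkEquiv (Nf := Nf) (L := 2 * S + 1)) quarkEquiv (Matrix.of fun v w : QuarkVar Nf (2 * S + 1) => if v.1 = w.1 ∧ v.2.1 = w.2.1 ∧ v.2.2.1 = w.2.2.1 then (if v.1 = f then (1 : ℂ) else if v.1 = g then -1 else 0) * ((μl : ℂ) * Complex.I) * gammaFive v.2.2.2 w.2.2.2 else 0); let E := fun (β m₀ μl : ℝ) (S : ℕ) (X : GaugeConfig 4 (2 * S + 1) (Matrix.specialUnitaryGroup (Fin 3) ℂ) → FermiAlg Nf (2 * S + 1)) => (∫ U, fermiIntegral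 (X U * grassmannExp (quadratic ℂ (-(diracMatrix U (fun _ : Fin Nf => m₀) + Tw S μl)))) ∂(wilsonMeasure (d := 4) (L := 2 * S + 1) (fundamentalRep (Fin 3)) β)) / (∫ U, fermiIntegral (grassmannExp (quadratic ℂ (-(diracMatrix U (fun _ : Fin Nf => m₀) + Tw S μl)))) ∂(wilsonMeasure (d := 4) (L := 2 * S + 1) (fundamentalRep (Fin 3)) β)); let Φ := fun (β m₀ μl : ℝ) (S : ℕ) (s₀ : ℕ) => ∑ y ∈ box 3 S, E β m₀ μl S (fun U => (V2.onTorus (2 * S + 1) (Matrix.vecCons ((s₀ : ℤ) - 1) y) U - V2.onTorus (2 * S + 1) (Matrix.vecCons (-(s₀ : ℤ)) y) U) * P1.onTorus (2 * S + 1) 0 U); ∃ φ₀ : ℝ, 0 < φ₀ ∧ ∃ τ : ℝ, 0 < τ ∧ ∀ t₁ : ℝ, 0 < t₁ → ∃ t : ℝ, 0 < t ∧ t ≤ t₁ ∧ ∃ L' : ℕ → ℕ, ∀ᶠ k in atTop, ∀ S : ℕ, L' k ≤ S → ⌈τ / reg.a k⌉₊ ≤ S → φ₀ ≤ (reg.a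 k ^ 3 * reg.Zm k)⁻¹ * ‖Φ (reg.β k) (reg.mcrit k + reg.a k * t / reg.Zm k) (reg.a k * t / reg.Zm k) S ⌈τ / reg.a k⌉₊‖

end Stmt

/-! ## §2 The registered stubs (the ONLY `sorry`s of this file; raw self-contained signatures = `Stmt.stub_*` verbatim; E1 landed) -/

/-! (E1) `stub_slabFluxBound` — the slab flux bound — is LANDED (p169063, K = 2, exact identity `Φ(s₀) = −2μ Σ C(s)`):
`Summit.QuantumFields.QCD.Cruxes.ChiralCornerSoftness.TwistedRay.stub_slabFluxBound` of the imported tree module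
`Summits.QuantumFields.QCD.Theorems.EulerDescentChiralCornerSoftnessStubSlabFluxBound`; its statement is kept above as
`Stmt.stub_slabFluxBound` (definitionally the landed theorem's type, see `slabFluxBound_holds`). -/

/-- **(E5) twist stability** (`= Stmt.stub_twistStability`; OPEN: universality between twisted-mass and untwisted
Wilson quarks at the rotated positive tuple, inside the reductio; `O(a²)` splittings vanish eventually in `k`). -/
theorem stub_twistStability :
    ∀ Nf : ℕ, Nf = 2 ∨ Nf = 3 → ∀ (reg : QCDRegularisation Nf) (mc : ℕ → ℝ),
      (∀ᶠ k in atTop, IsLUB {μ : ℝ | ¬ (∀ (R R' : ℕ) (A : QCDLatticeObservable Nf R)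
          (B : QCDLatticeObservable Nf R'), ∃ (C δ : ℝ) (S₀ : ℕ), 0 < δ ∧ ∀ S : ℕ, S₀ ≤ S → ∀ n : ℕ, n ≤ S →
            ‖qcdLatticeConnectedCorr (reg.β k) (2 * S + 1) (fun _ : Fin Nf => μ) A B n‖ ≤
              C * Real.exp (-(δ * n)))} (mc k)) →
      Tendsto (fun k => (reg.mcrit k - mc k) * reg.Zm k / reg.a k) atTop (nhds 0) →
      reg.HasMassScaling → (reg.scheme 0 0 0).HasAsymptoticScaling →
      (∀ᶠ k in atTop, (-1 : ℝ) < reg.mcrit k) →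
      ∀ (f g : Fin Nf), f ≠ g → let Tw := fun (S : ℕ) (μl : ℝ) => Matrix.reindex (quarkEquiv (Nf := Nf) (L := 2 * S + 1)) quarkEquiv (Matrix.of fun v w : QuarkVar Nf (2 * S + 1) => if v.1 = w.1 ∧ v.2.1 = w.2.1 ∧ v.2.2.1 = w.2.2.1 then (if v.1 = f then (1 : ℂ) else if v.1 = g then -1 else 0) * ((μl : ℂ) * Complex.I) * gammaFive v.2.2.2 w.2.2.2 else 0); let E := fun (β m₀ μl : ℝ) (S : ℕ) (X : GaugeConfig 4 (2 * S + 1) (Matrix.specialUnitaryGroup (Fin 3) ℂ) → FermiAlg Nf (2 * S + 1)) => (∫ U, fermiIntegral (X U * grassmannExp (quadratic ℂ (-(diracMatrix U (fun _ : Fin Nf => m₀) + Tw S μl)))) ∂(wilsonMeasure (d := 4) (L := 2 * S + 1) (fundamentalRep (Fin 3)) β)) / (∫ U, fermiIntegral (grassmannExp (quadratic ℂ (-(diracMatrix U (fun _ : Fin Nf => m₀) + Tw S μl)))) ∂(wilsonMeasure (d := 4) (L := 2 * S + 1) (fundamentalRep (Fin 3)) β)); let TwGap := fun (t μ Δ :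 ℝ) => ∀ (R R' : ℕ) (A : QCDLatticeObservable Nf R) (B : QCDLatticeObservable Nf R'), ∃ Cc : ℝ, ∀ᶠ k in atTop, ∀ S : ℕ, reg.L k ≤ S → ∀ n : ℕ, n ≤ S → ‖E (reg.β k) (reg.mcrit k + reg.a k * t / reg.Zm k) (reg.a k * μ / reg.Zm k) S (fun U => A.onTorus (2 * S + 1) 0 U * B.onTorus (2 * S + 1) (Pi.single 0 (n : ℤ)) U) - E (reg.β k) (reg.mcrit k + reg.a k * t / reg.Zm k) (reg.a k * μ / reg.Zm k) S (A.onTorus (2 * S + 1) 0) * E (reg.β k) (reg.mcrit k + reg.a k * t / reg.Zm k) (reg.a k * μ / reg.Zm k) S (B.onTorus (2 * S + 1) (Pi.single 0 (n : ℤ)))‖ ≤ Cc * Real.exp (-(Δ * (reg.a k * n))); ∀ ε : ℝ, 0 < ε → (∀ m : Fin Nf → ℝ, (∀ i, 0 < m i) → (reg.scheme m 0 0).HasLatticeMassGap ε) → ∀ t : ℝ, 0 < t → t ≤ 1 → TwGap t t (ε / 2) := by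
  sorry

/-- **(E2+E4) the twisted `P¹P¹` ceiling with decay under the twisted gap** (`= Stmt.stub_twistedPPCeiling`; OPEN:
reflection-positivity / transfer-matrix regularity of the zero-momentum charged correlator, uniform on small rays;
`m_crit > −1` = positivity range of the twisted transfer matrix). -/
theorem stub_twistedPPCeiling :
    ∀ Nf : ℕ, Nf = 2 ∨ Nf = 3 → ∀ (reg : QCDRegularisation Nf) (mc : ℕ → ℝ),
      (∀ᶠ k in atTop, IsLUB {μ : ℝ | ¬ (∀ (R R' : ℕ) (A : QCDLatticeObservable Nf R)
          (B : QCDLatticeObservable Nf R'), ∃ (C δ : ℝ) (S₀ : ℕ), 0 < δ ∧ ∀ S : ℕ, S₀ ≤ S → ∀ n : ℕ, n ≤ S →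
            ‖qcdLatticeConnectedCorr (reg.β k) (2 * S + 1) (fun _ : Fin Nf => μ) A B n‖ ≤
              C * Real.exp (-(δ * n)))} (mc k)) →
      Tendsto (fun k => (reg.mcrit k - mc k) * reg.Zm k / reg.a k) atTop (nhds 0) →
      reg.HasMassScaling → (reg.scheme 0 0 0).HasAsymptoticScaling →
      (∀ᶠ k in atTop, (-1 : ℝ) < reg.mcrit k) →
      ∀ (f g : Fin Nf), f ≠ g → let τ1 : Matrix (Fin Nf) (Fin Nf) ℂ := Matrix.single f g 1 + Matrix.single g f 1; let P1 : QCDLatticeObservable Nf 1 := pseudoscalarDensityObs Nf τ1; let Tw := fun (S : ℕ) (μl : ℝ) => Matrix.reindex (quarkEquiv (Nf := Nf) (L := 2 * S + 1)) quarkEquiv (Matrix.of fun v w : QuarkVar Nf (2 * S + 1) => if v.1 = w.1 ∧ v.2.1 = w.2.1 ∧ v.2.2.1 = w.2.2.1 then (if v.1 = f then (1 : ℂ) else if v.1 = g then -1 else 0) * ((μl : ℂ) * Complex.I) * gammaFive v.2.2.2 w.2.2.2 else 0); let E := fun (β m₀ μl : ℝ) (S : ℕ) (X : GaugeConfig 4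 (2 * S + 1) (Matrix.specialUnitaryGroup (Fin 3) ℂ) → FermiAlg Nf (2 * S + 1)) => (∫ U, fermiIntegral (X U * grassmannExp (quadratic ℂ (-(diracMatrix U (fun _ : Fin Nf => m₀) + Tw S μl)))) ∂(wilsonMeasure (d := 4) (L := 2 * S + 1) (fundamentalRep (Fin 3)) β)) / (∫ U, fermiIntegral (grassmannExp (quadratic ℂ (-(diracMatrix U (fun _ : Fin Nf => m₀) + Tw S μl)))) ∂(wilsonMeasure (d := 4) (L := 2 * S + 1) (fundamentalRep (Fin 3)) β)); let C := fun (β m₀ μl : ℝ) (S : ℕ) (s : ℤ) => ∑ y ∈ box 3 S, E β m₀ μl S (fun U => P1.onTorus (2 * S + 1) 0 U * P1.onTorus (2 * S + 1) (Matrix.vecCons s y) U); let TwGap := fun (t μ Δ : ℝ) => ∀ (R R' : ℕ) (A : QCDLatticeObservable Nf R) (B : QCDLatticeObservable Nf R'), ∃ Cc : ℝ, ∀ᶠ k in atTop, ∀ S : ℕ, reg.L k ≤ S → ∀ n : ℕ, n ≤ S → ‖E (reg.β k) (reg.mcrit k + reg.a k * t / reg.Zm k) (reg.a k * μ / reg.Zm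 k) S (fun U => A.onTorus (2 * S + 1) 0 U * B.onTorus (2 * S + 1) (Pi.single 0 (n : ℤ)) U) - E (reg.β k) (reg.mcrit k + reg.a k * t / reg.Zm k) (reg.a k * μ / reg.Zm k) S (A.onTorus (2 * S + 1) 0) * E (reg.β k) (reg.mcrit k + reg.a k * t / reg.Zm k) (reg.a k * μ / reg.Zm k) S (B.onTorus (2 * S + 1) (Pi.single 0 (n : ℤ)))‖ ≤ Cc * Real.exp (-(Δ * (reg.a k * n))); ∀ ε : ℝ, 0 < ε → ∀ τ : ℝ, 0 < τ → ∃ cbar : ℝ, 0 ≤ cbar ∧ ∀ t : ℝ, 0 < t → t ≤ 1 → TwGap t t (ε / 2) → ∃ L' : ℕ → ℕ, ∀ᶠ k in atTop, ∀ S : ℕ, L' k ≤ S → ∀ s : ℕ, τ ≤ reg.a k * s → τ ≤ reg.a k * ((2 * S + 1 : ℝ) - s) → ‖C (reg.β k) (reg.mcrit k + reg.a k * t / reg.Zm k) (reg.a k * t / reg.Zm k) S s‖ ≤ cbar * reg.a k ^ 3 * reg.Zm k ^ 2 * (Real.exp (-(ε / 4 * (reg.a k * s - τ))) + Real.exp (-(ε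 / 4 * (reg.a k * ((2 * S + 1 : ℝ) - s) - τ)))) := by
  sorry

/-- **(E3) the condensate flux floor on the 45° ray from the pin** (`= Stmt.stub_condensateFluxFloor`; OPEN, hardest:
chiral symmetry breaking for `N_f = 2,3` along AF Wilson trajectories, in the exact-flavour-symmetry, subtraction-free,
flux form — an infrared lower bound on ONE current–density two-point function at ONE physical distance). -/
theorem stub_condensateFluxFloor :
    ∀ Nf : ℕ, Nf = 2 ∨ Nf = 3 → ∀ (reg : QCDRegularisation Nf) (mc : ℕ → ℝ),
      (∀ᶠ k in atTop, IsLUB {μ : ℝ | ¬ (∀ (R R' : ℕ) (A : QCDLatticeObservable Nf R)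
          (B : QCDLatticeObservable Nf R'), ∃ (C δ : ℝ) (S₀ : ℕ), 0 < δ ∧ ∀ S : ℕ, S₀ ≤ S → ∀ n : ℕ, n ≤ S →
            ‖qcdLatticeConnectedCorr (reg.β k) (2 * S + 1) (fun _ : Fin Nf => μ) A B n‖ ≤
              C * Real.exp (-(δ * n)))} (mc k)) →
      Tendsto (fun k => (reg.mcrit k - mc k) * reg.Zm k / reg.a k) atTop (nhds 0) →
      reg.HasMassScaling → (reg.scheme 0 0 0).HasAsymptoticScaling →
      (∀ᶠ k in atTop, (-1 : ℝ) < reg.mcrit k) →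
      ∀ (f g : Fin Nf), f ≠ g → let τ1 : Matrix (Fin Nf) (Fin Nf) ℂ := Matrix.single f g 1 + Matrix.single g f 1; let τ2 : Matrix (Fin Nf) (Fin Nf) ℂ := (-Complex.I) • Matrix.single f g 1 + Complex.I • Matrix.single g f 1; let P1 : QCDLatticeObservable Nf 1 := pseudoscalarDensityObs Nf τ1; let V2 : QCDLatticeObservable Nf 1 := conservedVectorCurrent Nf τ2 0; let Tw := fun (S : ℕ) (μl : ℝ) => Matrix.reindex (quarkEquiv (Nf := Nf) (L := 2 * S + 1)) quarkEquiv (Matrix.of fun v w : QuarkVar Nf (2 * S + 1) => if v.1 = w.1 ∧ v.2.1 = w.2.1 ∧ v.2.2.1 = w.2.2.1 then (if v.1 = f then (1 : ℂ) else if v.1 = g then -1 else 0) * ((μl : ℂ) * Complex.I) * gammaFive v.2.2.2 w.2.2.2 else 0); let E := fun (β m₀ μl : ℝ) (S : ℕ) (X : GaugeConfig 4 (2 * S + 1) (Matrix.specialUnitaryGroup (Fin 3) ℂ) → FermiAlg Nf (2 * S + 1)) => (∫ U, fermiIntegral (X U * grassmannExp (quadratic ℂ (-(diracMatrix U (fun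 _ : Fin Nf => m₀) + Tw S μl)))) ∂(wilsonMeasure (d := 4) (L := 2 * S + 1) (fundamentalRep (Fin 3)) β)) / (∫ U, fermiIntegral (grassmannExp (quadratic ℂ (-(diracMatrix U (fun _ : Fin Nf => m₀) + Tw S μl)))) ∂(wilsonMeasure (d := 4) (L := 2 * S + 1) (fundamentalRep (Fin 3)) β)); let Φ := fun (β m₀ μl : ℝ) (S : ℕ) (s₀ : ℕ) => ∑ y ∈ box 3 S, E β m₀ μl S (fun U => (V2.onTorus (2 * S + 1) (Matrix.vecCons ((s₀ : ℤ) - 1) y) U - V2.onTorus (2 * S + 1) (Matrix.vecCons (-(s₀ : ℤ)) y) U) * P1.onTorus (2 * S + 1) 0 U); ∃ φ₀ : ℝ, 0 < φ₀ ∧ ∃ τ : ℝ, 0 < τ ∧ ∀ t₁ : ℝ, 0 < t₁ → ∃ t : ℝ, 0 < t ∧ t ≤ t₁ ∧ ∃ L' : ℕ → ℕ, ∀ᶠ k in atTop, ∀ S : ℕ, L' k ≤ S → ⌈τ / reg.a k⌉₊ ≤ S → φ₀ ≤ (reg.a k ^ 3 * reg.Zm k)⁻¹ * ‖Φ (reg.β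 k) (reg.mcrit k + reg.a k * t / reg.Zm k) (reg.a k * t / reg.Zm k) S ⌈τ / reg.a k⌉₊‖ := by
  sorry

/-! ## §3 Raw ↔ named (definitional bridges, `Iff.rfl`) -/

section Bridges

/-- Shape of E1 in the file-local vocabulary. [folklore] -/
def Nice.slabFluxBound : Prop :=
  ∃ K : ℝ, 0 ≤ K ∧ ∀ (Nf : ℕ) (f g : Fin Nf), f ≠ g → ∀ (β m₀ μl : ℝ) (S s₀ : ℕ), 0 ≤ μl → 1 ≤ s₀ → s₀ ≤ S →
    ‖slabFlux f g β m₀ μl S s₀‖ ≤ K * μl * ∑ s ∈ slab S s₀, ‖zeroMomPP f g β m₀ μl S s‖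

/-- Crux hypothesis package of a regularisation (corner, pin, mass scaling, asymptotic scaling, branch). [folklore] -/
def CornerPinned {Nf : ℕ} (reg : QCDRegularisation Nf) (mc : ℕ → ℝ) : Prop :=
  (∀ᶠ k in atTop, IsLUB {μ : ℝ | ¬ (∀ (R R' : ℕ) (A : QCDLatticeObservable Nf R)
      (B : QCDLatticeObservable Nf R'), ∃ (C δ : ℝ) (S₀ : ℕ), 0 < δ ∧ ∀ S : ℕ, S₀ ≤ S → ∀ n : ℕ, n ≤ S →
        ‖qcdLatticeConnectedCorr (reg.β k) (2 * S + 1) (fun _ : Fin Nf => μ) A B n‖ ≤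
          C * Real.exp (-(δ * n)))} (mc k)) ∧
  Tendsto (fun k => (reg.mcrit k - mc k) * reg.Zm k / reg.a k) atTop (nhds 0) ∧
  reg.HasMassScaling ∧ (reg.scheme 0 0 0).HasAsymptoticScaling ∧
  (∀ᶠ k in atTop, (-1 : ℝ) < reg.mcrit k)

/-- Shape of E5 in the file-local vocabulary. [folklore] -/
def Nice.twistStability : Prop :=
  ∀ Nf : ℕ, Nf = 2 ∨ Nf = 3 → ∀ (reg : QCDRegularisation Nf) (mc : ℕ → ℝ), CornerPinned reg mc →
    ∀ (f g : Fin Nf), f ≠ g → ∀ ε : ℝ, 0 < ε →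
      (∀ m : Fin Nf → ℝ, (∀ i, 0 < m i) → (reg.scheme m 0 0).HasLatticeMassGap ε) →
      ∀ t : ℝ, 0 < t → t ≤ 1 → TwistedGap reg f g t t (ε / 2)

/-- Shape of E2+E4 in the file-local vocabulary. [folklore] -/
def Nice.twistedPPCeiling : Prop :=
  ∀ Nf : ℕ, Nf = 2 ∨ Nf = 3 → ∀ (reg : QCDRegularisation Nf) (mc : ℕ → ℝ), CornerPinned reg mc →
    ∀ (f g : Fin Nf), f ≠ g → ∀ ε : ℝ, 0 < ε → ∀ τ : ℝ, 0 < τ → ∃ cbar : ℝ, 0 ≤ cbar ∧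
      ∀ t : ℝ, 0 < t → t ≤ 1 → TwistedGap reg f g t t (ε / 2) → ∃ L' : ℕ → ℕ, ∀ᶠ k in atTop, ∀ S : ℕ, L' k ≤ S →
        ∀ s : ℕ, τ ≤ reg.a k * s → τ ≤ reg.a k * ((2 * S + 1 : ℝ) - s) →
          ‖zeroMomPP f g (reg.β k) (reg.mcrit k + reg.a k * t / reg.Zm k) (reg.a k * t / reg.Zm k) S s‖ ≤
            cbar * reg.a k ^ 3 * reg.Zm k ^ 2 *
              (Real.exp (-(ε / 4 * (reg.a k * s - τ))) + Real.exp (-(ε / 4 * (reg.a k * ((2 * S + 1 : ℝ) - s) - τ))))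

/-- Shape of E3 in the file-local vocabulary. [folklore] -/
def Nice.condensateFluxFloor : Prop :=
  ∀ Nf : ℕ, Nf = 2 ∨ Nf = 3 → ∀ (reg : QCDRegularisation Nf) (mc : ℕ → ℝ), CornerPinned reg mc →
    ∀ (f g : Fin Nf), f ≠ g → ∃ φ₀ : ℝ, 0 < φ₀ ∧ ∃ τ : ℝ, 0 < τ ∧ ∀ t₁ : ℝ, 0 < t₁ →
      ∃ t : ℝ, 0 < t ∧ t ≤ t₁ ∧ ∃ L' : ℕ → ℕ, ∀ᶠ k in atTop, ∀ S : ℕ, L' k ≤ S → ⌈τ / reg.a k⌉₊ ≤ S →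
        φ₀ ≤ (reg.a k ^ 3 * reg.Zm k)⁻¹ *
          ‖slabFlux f g (reg.β k) (reg.mcrit k + reg.a k * t / reg.Zm k) (reg.a k * t / reg.Zm k) S ⌈τ / reg.a k⌉₊‖

/-- E1 raw ↔ named. [folklore] -/
theorem slabFluxBound_iff : Stmt.stub_slabFluxBound ↔ Nice.slabFluxBound := Iff.rfl

/-- E1 HOLDS (landed tree theorem `stub_slabFluxBound`, p169063), in the named form. [folklore] -/
theorem slabFluxBound_holds : Nice.slabFluxBound := slabFluxBound_iff.mp stub_slabFluxBound

/-- E5 raw → named. [folklore] -/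
theorem twistStability_nice (h : Stmt.stub_twistStability) : Nice.twistStability :=
  fun Nf hNf reg mc hcp => h Nf hNf reg mc hcp.1 hcp.2.1 hcp.2.2.1 hcp.2.2.2.1 hcp.2.2.2.2

/-- E2+E4 raw → named. [folklore] -/
theorem twistedPPCeiling_nice (h : Stmt.stub_twistedPPCeiling) : Nice.twistedPPCeiling :=
  fun Nf hNf reg mc hcp => h Nf hNf reg mc hcp.1 hcp.2.1 hcp.2.2.1 hcp.2.2.2.1 hcp.2.2.2.2

/-- E3 raw → named. [folklore] -/
theorem condensateFluxFloor_nice (h : Stmt.stub_condensateFluxFloor) : Nice.condensateFluxFloor :=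
  fun Nf hNf reg mc hcp => h Nf hNf reg mc hcp.1 hcp.2.1 hcp.2.2.1 hcp.2.2.2.1 hcp.2.2.2.2

end Bridges

/-! ## §3b Certificates of the twisted objects (LANDED periphery, imported; documentation for E5/E2+E4/E3 workers) -/

section Certificates

variable {Nf : ℕ}

/-- **Zero-twist slice of the twisted gap clause** (landed `stub_twistStability_zeroTwist`, p172396): at `μ = 0` the clause
`TwistedGap reg f g t 0 Δ` is VERBATIM the crux's clause `HasLatticeMassGap Δ` of the untwisted degenerate scheme
`reg.scheme (fun _ => t) 0 0` — E5's conclusion lives in the crux's own currency. [folklore] -/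
theorem twistedGap_zero_iff (reg : QCDRegularisation Nf) (f g : Fin Nf) (t Δ : ℝ) :
    TwistedGap reg f g t 0 Δ ↔ (reg.scheme (fun _ : Fin Nf => t) 0 0).HasLatticeMassGap Δ :=
  stub_twistStability_zeroTwist Nf reg f g t Δ

/-- **The twisted denominator is real** for every `N_f` and `f ≠ g` (landed `stub_condensateFluxFloor_denominatorReal`,
p172463: pointwise `det(Q² + μ²)·∏_{h ∉ {f,g}} det(D_W + m₀)`, `γ₅`-Hermiticity). [cite: FrezzottiGrassiSintWeisz2001, §2.1] -/
theorem twDenominator_im_eq_zero {f g : Fin Nf} (hfg : f ≠ g) (β m₀ μl : ℝ) (S : ℕ) :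
    (∫ U, fermiIntegral (grassmannExp (quadratic ℂ (-(diracMatrix U (fun _ : Fin Nf => m₀) + twistMatrix f g S μl))))
      ∂(wilsonMeasure (d := 4) (L := 2 * S + 1) (fundamentalRep (Fin 3)) β)).im = 0 :=
  stub_condensateFluxFloor_denominatorReal Nf f g hfg β m₀ μl S

/-- **Only finitely many junk ray parameters**: on the ray `(m₀, μ) = (m_c + c t, c t)`, `c ≠ 0`, at fixed `(β, S)` the
twisted denominator (a polynomial in `t` with leading coefficient `det(1 + iγ₅τ³-blocks) ≠ 0`) vanishes at finitely many `t`
(landed `stub_condensateFluxFloor_rayZerosFinite`, p172610) — so E3's `∀ t₁ > 0, ∃ t ≤ t₁` only has to avoid a countable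
set of `t` (all `(k, S)` together). [folklore] -/
theorem rayZeros_finite (f g : Fin Nf) (β mc c : ℝ) (S : ℕ) (hc : c ≠ 0) :
    Set.Finite {t : ℝ | (∫ U, fermiIntegral (grassmannExp (quadratic ℂ
      (-(diracMatrix U (fun _ : Fin Nf => mc + c * t) + twistMatrix f g S (c * t)))))
        ∂(wilsonMeasure (d := 4) (L := 2 * S + 1) (fundamentalRep (Fin 3)) β)) = 0} :=
  stub_condensateFluxFloor_rayZerosFinite Nf f g β mc c S hc

end Certificates

/-! ## §4 Real-analysis helpers for the composition (sorry-free) -/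

section Helpers

variable {Nf : ℕ}

/-- Negating the pin: a regularisation that is not chiral at zero has ONE rate at ALL positive tuples. [folklore] -/
theorem uniformGap_of_not_isChiralAtZero (reg : QCDRegularisation Nf) (h : ¬ reg.IsChiralAtZero) :
    ∃ ε : ℝ, 0 < ε ∧ ∀ m : Fin Nf → ℝ, (∀ f, 0 < m f) → (reg.scheme m 0 0).HasLatticeMassGap ε := by
  unfold QCDRegularisation.IsChiralAtZero at h
  push Not at h
  obtain ⟨ε, hε, hm⟩ := h
  exact ⟨ε, hε, hm⟩

/-- Membership in the slab. [folklore] -/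
theorem mem_slab {S s₀ s : ℕ} : s ∈ slab S s₀ ↔ s₀ ≤ s ∧ s + s₀ ≤ 2 * S + 1 := by
  simp only [slab, Finset.mem_filter, Finset.mem_range]
  constructor
  · rintro ⟨-, h⟩; exact h
  · rintro h; exact ⟨by omega, h⟩

/-- A geometric tail over any finite set of exponents `≥ s₀`. [folklore] -/
theorem sum_pow_le_of_le {q : ℝ} (hq0 : 0 ≤ q) (hq1 : q < 1) (F : Finset ℕ) (s₀ : ℕ) (hF : ∀ s ∈ F, s₀ ≤ s) :
    ∑ s ∈ F, q ^ s ≤ q ^ s₀ / (1 - q) := by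
  set M : ℕ := F.sup id + 1 with hM
  have hsub : F ⊆ Finset.Ico s₀ M := by
    intro s hs
    rw [Finset.mem_Ico]
    refine ⟨hF s hs, ?_⟩
    have : s ≤ F.sup id := Finset.le_sup (f := id) hs
    omega
  calc ∑ s ∈ F, q ^ s ≤ ∑ s ∈ Finset.Ico s₀ M, q ^ s :=
        Finset.sum_le_sum_of_subset_of_nonneg hsub fun _ _ _ => pow_nonneg hq0 _
    _ ≤ q ^ s₀ / (1 - q) := geom_sum_Ico_le_of_lt_one hq0 hq1

/-- `1/(1 − e^{−x}) ≤ 2/x` on `(0, 1]`, in the form `e^{−x} ≤ 1 − x/2`. [folklore] -/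
theorem exp_neg_le_one_sub_half {x : ℝ} (hx0 : 0 ≤ x) (hx1 : x ≤ 1) : Real.exp (-x) ≤ 1 - x / 2 := by
  have h1 : Real.exp (-x) ≤ 1 / (1 + x) := by
    rw [Real.exp_neg, one_div]
    exact inv_anti₀ (by linarith) (by linarith [Real.add_one_le_exp x])
  have h2 : 1 / (1 + x) ≤ 1 - x / 2 := by
    rw [div_le_iff₀ (by linarith)]
    nlinarith
  exact h1.trans h2

/-- The slab sum of the two decaying exponentials of E2+E4 is at most `8/(ε a)` once `ε a/2 ≤ 1` and `τ ≤ a s₀`.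
[folklore] -/
theorem slab_sum_exp_le {ε a τ : ℝ} (hε : 0 < ε) (ha : 0 < a) (hx1 : ε / 2 * a ≤ 1) {S s₀ : ℕ}
    (hs₀ : τ ≤ a * s₀) :
    ∑ s ∈ slab S s₀, (Real.exp (-(ε / 2 * (a * s - τ))) + Real.exp (-(ε / 2 * (a * ((2 * S + 1 : ℝ) - s) - τ)))) ≤
      8 / (ε * a) := by
  set x : ℝ := ε / 2 * a with hx
  have hx0 : 0 < x := by positivity
  set q : ℝ := Real.exp (-x) with hq
  have hq0 : 0 ≤ q := (Real.exp_pos _).le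
  have hq1 : q < 1 := by rw [hq]; exact Real.exp_lt_one_iff.mpr (by linarith)
  have h1q : 0 < 1 - q := by linarith
  -- the key one-sided estimate: Σ_{s ∈ slab} e^{−(ε/2)(a s − τ)} ≤ 1/(1−q)
  have hside : ∀ (F : Finset ℕ), (∀ s ∈ F, s₀ ≤ s) →
      ∑ s ∈ F, Real.exp (-(ε / 2 * (a * s - τ))) ≤ 1 / (1 - q) := by
    intro F hF
    have hterm : ∀ s : ℕ, Real.exp (-(ε / 2 * (a * s - τ))) = Real.exp (ε / 2 * τ) * q ^ s := by
      intro s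
      rw [hq, ← Real.exp_nat_mul, ← Real.exp_add]
      congr 1
      rw [hx]; ring
    simp_rw [hterm, ← Finset.mul_sum]
    have hgeo := sum_pow_le_of_le hq0 hq1 F s₀ hF
    have hpre : Real.exp (ε / 2 * τ) * q ^ s₀ ≤ 1 := by
      rw [hq, ← Real.exp_nat_mul, ← Real.exp_add]
      apply Real.exp_le_one_iff.mpr
      have : ε / 2 * τ ≤ ε / 2 * (a * s₀) := by gcongr
      rw [hx]; nlinarith
    calc Real.exp (ε / 2 * τ) * ∑ s ∈ F, q ^ s ≤ Real.exp (ε / 2 * τ) * (q ^ s₀ / (1 - q)) := by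
          gcongr
      _ = Real.exp (ε / 2 * τ) * q ^ s₀ / (1 - q) := by ring
      _ ≤ 1 / (1 - q) := by gcongr
  -- the mirrored sum equals a sum of the same shape over the reflected slab
  have hmirror : ∑ s ∈ slab S s₀, Real.exp (-(ε / 2 * (a * ((2 * S + 1 : ℝ) - s) - τ))) =
      ∑ s ∈ slab S s₀, Real.exp (-(ε / 2 * (a * s - τ))) := by
    refine Finset.sum_nbij' (fun s => 2 * S + 1 - s) (fun s => 2 * S + 1 - s) ?_ ?_ ?_ ?_ ?_
    · intro s hs
      simp only [mem_slab] at hs ⊢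
      omega
    · intro s hs
      simp only [mem_slab] at hs ⊢
      omega
    · intro s hs
      simp only [mem_slab] at hs
      omega
    · intro s hs
      simp only [mem_slab] at hs
      omega
    · intro s hs
      rw [mem_slab] at hs
      have hle : s ≤ 2 * S + 1 := by omega
      congr 2
      push_cast [Nat.cast_sub hle]
      ring
  rw [Finset.sum_add_distrib, hmirror, ← two_mul]
  have hF : ∀ s ∈ slab S s₀, s₀ ≤ s := fun s hs => (mem_slab.mp hs).1
  have hone := hside _ hF
  -- 1/(1−q) ≤ 2/x
  have hq' : q ≤ 1 - x / 2 := exp_neg_le_one_sub_half hx0.le hx1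
  have h3 : 1 / (1 - q) ≤ 2 / x := by
    rw [div_le_div_iff₀ h1q hx0]
    nlinarith
  calc 2 * ∑ s ∈ slab S s₀, Real.exp (-(ε / 2 * (a * s - τ))) ≤ 2 * (2 / x) := by
        gcongr; exact hone.trans h3
    _ = 8 / (ε * a) := by rw [hx]; field_simp; ring

end Helpers

/-! ## §5 Composition (kernel-checked): the crux BY NAME from the three open stub statements and the landed E1 -/

/-- **THE CRUX FROM THE STUBS** — concludes `Summit.QuantumFields.QCD.Theses.EulerDescent.ChiralCornerSoftness` BY
NAME: negate the pin (one rate `ε` at all positive tuples), get the twisted gap `ε/2` on the 45° ray (E5), bound the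
renormalised flux at physical time `τ` from above by `16 K c̄ t/ε` through the LANDED slab Ward bound (E1, `K = 2`) and
the ceiling with decay (E2+E4, rate `ε/4`, own volume threshold) plus two geometric sums, and contradict the flux floor
`φ₀` (E3) at a ray parameter `t ≤ min 1 (ε φ₀/(16 K c̄ + 16))` supplied by E3, on a common large torus. [folklore] -/
theorem ChiralCornerSoftness_of :
    Stmt.stub_twistStability → Stmt.stub_twistedPPCeiling → Stmt.stub_condensateFluxFloor → ChiralCornerSoftness := by
  intro hE5raw hE24raw hE3raw Nf hNf reg mc hcorner hpin hms haf hbr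
  have hE1 : Nice.slabFluxBound := slabFluxBound_holds
  have hE5 : Nice.twistStability := twistStability_nice hE5raw
  have hE24 : Nice.twistedPPCeiling := twistedPPCeiling_nice hE24raw
  have hE3 : Nice.condensateFluxFloor := condensateFluxFloor_nice hE3raw
  have hcp : CornerPinned reg mc := ⟨hcorner, hpin, hms, haf, hbr⟩
  by_contra hchi
  obtain ⟨ε, hε, hgap⟩ := uniformGap_of_not_isChiralAtZero reg hchi
  -- the doublet
  have h2 : 2 ≤ Nf := by rcases hNf with rfl | rfl <;> norm_num
  set f : Fin Nf := ⟨0, by omega⟩ with hf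
  set g : Fin Nf := ⟨1, by omega⟩ with hg
  have hfg : f ≠ g := by simp [hf, hg, Fin.ext_iff]
  -- the stubs at this doublet
  obtain ⟨K, hK0, hK⟩ := hE1
  obtain ⟨φ₀, hφ₀, τ, hτ, hfloor⟩ := hE3 Nf hNf reg mc hcp f g hfg
  obtain ⟨cbar, hcbar0, hceil⟩ := hE24 Nf hNf reg mc hcp f g hfg ε hε τ hτ
  -- the small ray parameter: E3 supplies one below t₁ := min 1 (ε φ₀ /(16 K c̄ + 16))
  set t₁ : ℝ := min 1 (ε * φ₀ / (16 * K * cbar + 16)) with ht₁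
  have hKc : 0 ≤ 16 * K * cbar := by positivity
  have ht₁0 : 0 < t₁ := by
    rw [ht₁]; refine lt_min one_pos ?_; positivity
  obtain ⟨t, ht0, htt₁, L₂, hF⟩ := hfloor t₁ ht₁0
  have ht1 : t ≤ 1 := htt₁.trans (min_le_left _ _)
  have htsmall : 16 * K * cbar * t / ε < φ₀ := by
    have h1 : t ≤ ε * φ₀ / (16 * K * cbar + 16) := htt₁.trans (min_le_right _ _)
    have h2 : 16 * K * cbar * (ε * φ₀ / (16 * K * cbar + 16)) < ε * φ₀ := by
      rw [mul_div_assoc', div_lt_iff₀ (by positivity)]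
      nlinarith [mul_pos hε hφ₀]
    rw [div_lt_iff₀ hε]
    calc 16 * K * cbar * t ≤ 16 * K * cbar * (ε * φ₀ / (16 * K * cbar + 16)) := by gcongr
      _ < ε * φ₀ := h2
      _ = φ₀ * ε := by ring
  -- twisted gap on the ray, then ceiling and floor eventually in k (each with its own volume threshold)
  have htw : TwistedGap reg f g t t (ε / 2) := hE5 Nf hNf reg mc hcp f g hfg ε hε hgap t ht0 ht1
  obtain ⟨L₁, hC⟩ := hceil t ht0 ht1 htw
  have ha0 : Tendsto reg.a atTop (nhds 0) := reg.tendsto_a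
  have ha1 : ∀ᶠ k in atTop, reg.a k ≤ min 1 (4 / ε) :=
    (ha0.eventually (eventually_le_nhds (by positivity)))
  have hL : ∀ᶠ k in atTop, τ + 1 ≤ reg.a k * reg.L k :=
    reg.tendsto_L.eventually (eventually_ge_atTop _)
  obtain ⟨k, hCk, hFk, ha1k, hLk⟩ := (hC.and (hF.and (ha1.and hL))).exists
  -- abbreviations at this k
  have ha : 0 < reg.a k := reg.a_pos k
  have hZ : 0 < reg.Zm k := reg.Zm_pos k
  have hak1 : reg.a k ≤ 1 := ha1k.trans (min_le_left _ _)
  have hakε : ε / 2 / 2 * reg.a k ≤ 1 := by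
    have : reg.a k ≤ 4 / ε := ha1k.trans (min_le_right _ _)
    rw [le_div_iff₀ hε] at this
    linarith
  have hε2 : 0 < ε / 2 := half_pos hε
  -- the common torus: at least the clause's, E24's and E3's thresholds
  set S : ℕ := max (reg.L k) (max (L₁ k) (L₂ k)) with hS
  have hSL : reg.L k ≤ S := le_max_left _ _
  have hS₁ : L₁ k ≤ S := (le_max_left _ _).trans (le_max_right _ _)
  have hS₂ : L₂ k ≤ S := (le_max_right _ _).trans (le_max_right _ _)
  set s₀ : ℕ := ⌈τ / reg.a k⌉₊ with hs₀
  have hs₀1 : 1 ≤ s₀ := Nat.one_le_iff_ne_zero.mpr (Nat.pos_iff_ne_zero.mp (Nat.ceil_pos.mpr (by positivity)))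
  have hs₀τ : τ ≤ reg.a k * s₀ := by
    have := Nat.le_ceil (τ / reg.a k)
    rw [div_le_iff₀ ha] at this
    rw [hs₀]; linarith
  have hs₀S : s₀ ≤ S := by
    have hlt : (s₀ : ℝ) < τ / reg.a k + 1 := Nat.ceil_lt_add_one (by positivity)
    have h1 : reg.a k * s₀ < τ + reg.a k := by
      have := mul_lt_mul_of_pos_left hlt ha
      rwa [mul_add, mul_div_cancel₀ _ ha.ne', mul_one] at this
    have hLS : (reg.L k : ℝ) ≤ S := by exact_mod_cast hSL
    have h2 : reg.a k * s₀ < reg.a k * S := by nlinarith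
    exact_mod_cast (lt_of_mul_lt_mul_left h2 ha.le).le
  -- floor
  have hfl : φ₀ ≤ (reg.a k ^ 3 * reg.Zm k)⁻¹ *
      ‖slabFlux f g (reg.β k) (reg.mcrit k + reg.a k * t / reg.Zm k) (reg.a k * t / reg.Zm k) S s₀‖ :=
    hFk S hS₂ hs₀S
  -- E1 at this (β, m₀, μl, S, s₀)
  have hμl : 0 ≤ reg.a k * t / reg.Zm k := by positivity
  have hE1k := hK Nf f g hfg (reg.β k) (reg.mcrit k + reg.a k * t / reg.Zm k) (reg.a k * t / reg.Zm k) S s₀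
    hμl hs₀1 hs₀S
  -- ceiling, summed over the slab (rate ε/4 = (ε/2)/2)
  have hsum : ∑ s ∈ slab S s₀,
      ‖zeroMomPP f g (reg.β k) (reg.mcrit k + reg.a k * t / reg.Zm k) (reg.a k * t / reg.Zm k) S s‖ ≤
      cbar * reg.a k ^ 3 * reg.Zm k ^ 2 * (8 / (ε / 2 * reg.a k)) := by
    calc ∑ s ∈ slab S s₀,
          ‖zeroMomPP f g (reg.β k) (reg.mcrit k + reg.a k * t / reg.Zm k) (reg.a k * t / reg.Zm k) S s‖
        ≤ ∑ s ∈ slab S s₀, cbar * reg.a k ^ 3 * reg.Zm k ^ 2 *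
            (Real.exp (-(ε / 2 / 2 * (reg.a k * s - τ))) +
              Real.exp (-(ε / 2 / 2 * (reg.a k * ((2 * S + 1 : ℝ) - s) - τ)))) := by
          refine Finset.sum_le_sum fun s hs => ?_
          rw [mem_slab] at hs
          have h4 : ε / 2 / 2 = ε / 4 := by ring
          rw [h4]
          refine hCk S hS₁ s ?_ ?_
          · have : (s₀ : ℝ) ≤ s := by exact_mod_cast hs.1
            nlinarith
          · have : (s₀ : ℝ) ≤ (2 * S + 1 : ℝ) - s := by
              have h' : ((s + s₀ : ℕ) : ℝ) ≤ ((2 * S + 1 : ℕ) : ℝ) := by exact_mod_cast hs.2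
              push_cast at h'
              linarith
            nlinarith
      _ = cbar * reg.a k ^ 3 * reg.Zm k ^ 2 * ∑ s ∈ slab S s₀,
            (Real.exp (-(ε / 2 / 2 * (reg.a k * s - τ))) +
              Real.exp (-(ε / 2 / 2 * (reg.a k * ((2 * S + 1 : ℝ) - s) - τ)))) := by
          rw [Finset.mul_sum]
      _ ≤ cbar * reg.a k ^ 3 * reg.Zm k ^ 2 * (8 / (ε / 2 * reg.a k)) := by
          gcongr
          exact slab_sum_exp_le hε2 ha hakε hs₀τ
  -- assemble: (a³Z)⁻¹ ‖Φ‖ ≤ 16 K cbar t / ε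
  have hΦ : ‖slabFlux f g (reg.β k) (reg.mcrit k + reg.a k * t / reg.Zm k) (reg.a k * t / reg.Zm k) S s₀‖ ≤
      K * (reg.a k * t / reg.Zm k) * (cbar * reg.a k ^ 3 * reg.Zm k ^ 2 * (8 / (ε / 2 * reg.a k))) :=
    hE1k.trans (by gcongr)
  have hkey : (reg.a k ^ 3 * reg.Zm k)⁻¹ *
      ‖slabFlux f g (reg.β k) (reg.mcrit k + reg.a k * t / reg.Zm k) (reg.a k * t / reg.Zm k) S s₀‖ ≤
      16 * K * cbar * t / ε := by
    calc (reg.a k ^ 3 * reg.Zm k)⁻¹ *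
          ‖slabFlux f g (reg.β k) (reg.mcrit k + reg.a k * t / reg.Zm k) (reg.a k * t / reg.Zm k) S s₀‖
        ≤ (reg.a k ^ 3 * reg.Zm k)⁻¹ *
            (K * (reg.a k * t / reg.Zm k) * (cbar * reg.a k ^ 3 * reg.Zm k ^ 2 * (8 / (ε / 2 * reg.a k)))) := by
          gcongr
      _ = 16 * K * cbar * t / ε := by
          field_simp
          ring
  linarith [hfl.trans hkey]

/-- The crux along this skeleton, from the registered stubs (sorries only inside `stub_*`; also certifies that each
`Stmt.stub_<name>` is definitionally the signature of `stub_<name>`). -/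
theorem chiralCornerSoftness_of_stubs : ChiralCornerSoftness :=
  ChiralCornerSoftness_of stub_twistStability stub_twistedPPCeiling stub_condensateFluxFloor

end Summit.QuantumFields.QCD.Cruxes.ChiralCornerSoftness.TwistedRay

end
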